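import Summits.Ventures.Crystal3D.Theorems.StickyWulffConstantCoaxialWallLawEndRowRatMoves
import HarnessLib

/-!
# An integer model of the typed census row, V: the NARROW move (`WordVersion.v2`) in rational frames

HONEST FRAMING. Venture `Summits/Ventures/Crystal3D` (cell `crystal3d-full`), helper `--supports` the crux `CoaxialWallLaw`
(stmt-Ventures-19481, line `WallLedgerF`).  Continues `…EndRowRatMoves` (seat 19481-p1 gen 12).  The `v1` machinery refutes the
narrow disjunct of `IsMoving` by `v1 ≠ v2`; for census values under `WordVersion.v2` one needs the NARROW reading
(`IsNarrow X G d b`: `b + d ∈ X` and the positive triple of some menu normal crossing `d` upward is occupied) both as a predecessor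
qualification and — negated — at the end ball.  In a `RatFrame` with direction `d = τ • Φ(sᵢ)` (`τ = ±1`) both are Boolean tests on
the rational site set:

* `narrowOKQ / narrowFailQ` and their soundness `isNarrow_of` / `not_isNarrow`;
* `not_isMoving_any` — not moving under ANY word version from `fullQ = false`, all `twinFailQ`, and `narrowFailQ`;
* version-generic end moves `isEndMove_full_any`, `isEndMove_glide_any`, `isEndMove_narrow` (v2), `isEndMove_cross_any`
  (the target's direction in the reflected frame is `−σ • Φ'(sᵢ)`).
WHAT THIS IS NOT: no census constant is claimed here; F-C1 not moved.
-/

noncomputable section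

namespace Summit.Ventures.Crystal3D.Theorems

open Summit.Ventures.Crystal3D Finset NearIdentity
open Literature.MathematicalPhysics.StatisticalMechanics (barlowPos fccStacking constHagg)
open scoped InnerProductSpace

namespace EndRowFloor

/-! ### §13 The narrow reading in a rational frame -/

/-- NARROW success test for direction `τ gᵢ` at `v` across the menu vector `w c`. -/
def narrowOKQ (g : Fin 12 → (Fin 3 → ℚ)) (T : Finset (Fin 3 → ℚ)) (v : Fin 3 → ℚ) (i : Fin 12) (τ : ℤ) (c : Fin 8) :
    Bool :=
  decide (v + (τ : ℚ) • g i ∈ T ∧ τ * dz (slotInt i) (cubeInt c) = 2 ∧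
    ∀ j : Fin 12, 0 < dz (slotInt j) (cubeInt c) → v + g j ∈ T)

/-- NARROW failure test for direction `τ gᵢ` at `v`: every upward-crossed menu vector has a hole in its positive triple, or the
target is empty. -/
def narrowFailQ (g : Fin 12 → (Fin 3 → ℚ)) (T : Finset (Fin 3 → ℚ)) (v : Fin 3 → ℚ) (i : Fin 12) (τ : ℤ) : Bool :=
  decide (∀ c : Fin 8, τ * dz (slotInt i) (cubeInt c) = 2 →
    (v + (τ : ℚ) • g i ∉ T ∨ ∃ j : Fin 12, 0 < dz (slotInt j) (cubeInt c) ∧ v + g j ∉ T))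

/-- `2/√6 = √(2/3)`. -/
theorem two_div_sqrt_six : (2 : ℝ) / Real.sqrt 6 = Real.sqrt (2 / 3) := by
  rw [show (2 : ℝ) / 3 = 4 / 6 by norm_num, Real.sqrt_div (by norm_num), show (4 : ℝ) = 2 ^ 2 by norm_num,
    Real.sqrt_sq (by norm_num)]

/-- The signed slot image as a rational point step: `PQ v + τ • Φ(sᵢ) = PQ (v + τ • gᵢ)`. -/
theorem PQ_add_smul_slot (F : RatFrame) (v : Fin 3 → ℚ) (i : Fin 12) (τ : ℤ) :
    PQ v + ((τ : ℝ) • F.Φ (slotSite i)) = PQ (v + (τ : ℚ) • F.g i) := by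
  rw [F.hslot, PQ_add, iptQ_smul, map_smul]; push_cast; rfl

/-- Inner product of a signed slot image with a menu normal of the frame. -/
theorem inner_smul_slot_nv (F : RatFrame) (i : Fin 12) (τ : ℤ) (c : Fin 8) :
    ⟪(τ : ℝ) • F.Φ (slotSite i), nv (F.w c)⟫_ℝ = ((τ * dz (slotInt i) (cubeInt c) : ℤ) : ℝ) / Real.sqrt 6 := by
  rw [real_inner_smul_left, F.hinner]; push_cast; ring

/-- A narrow reading from the success test. -/
theorem RatFrame.isNarrow_of (F : RatFrame) {S : Finset (Fin 3 → ℤ)} {v : Fin 3 → ℚ} {i : Fin 12} {τ : ℤ} {c : Fin 8}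
    (h : narrowOKQ F.g (SQ S) v i τ c = true) : IsNarrow (Xof S) F.Φ ((τ : ℝ) • F.Φ (slotSite i)) (PQ v) := by
  rw [narrowOKQ, decide_eq_true_iff] at h
  obtain ⟨htarget, hup, hpos⟩ := h
  have h6 := sqrt6_pos
  refine ⟨by rw [PQ_add_smul_slot, mem_Xof_Q]; exact htarget, nv (F.w c), F.hmenu' c, ?_, ?_⟩
  · rw [inner_smul_slot_nv, hup, ← two_div_sqrt_six]; push_cast; rfl
  · intro w hw hwpos
    obtain ⟨j, rfl⟩ := exists_slotSite_eq hw
    rw [F.hinner] at hwpos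
    have hd : 0 < dz (slotInt j) (cubeInt c) := by
      by_contra hnp
      push Not at hnp
      have : (dz (slotInt j) (cubeInt c) : ℝ) / Real.sqrt 6 ≤ 0 :=
        div_nonpos_of_nonpos_of_nonneg (by exact_mod_cast hnp) h6.le
      linarith
    rw [PQ_add_slot, mem_Xof_Q]; exact hpos j hd

/-- No narrow reading from the failure test. -/
theorem RatFrame.not_isNarrow (F : RatFrame) {S : Finset (Fin 3 → ℤ)} {v : Fin 3 → ℚ} {i : Fin 12} {τ : ℤ}
    (h : narrowFailQ F.g (SQ S) v i τ = true) : ¬ IsNarrow (Xof S) F.Φ ((τ : ℝ) • F.Φ (slotSite i)) (PQ v) := by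
  rw [narrowFailQ, decide_eq_true_iff] at h
  rintro ⟨htarget, m, hmenu, hdm, hpos⟩
  obtain ⟨c, rfl⟩ := F.hmenu m hmenu
  have h6 := sqrt6_pos
  have hup : τ * dz (slotInt i) (cubeInt c) = 2 := by
    rw [inner_smul_slot_nv, ← two_div_sqrt_six] at hdm
    have := (div_left_inj' (ne_of_gt h6)).1 hdm
    exact_mod_cast this
  rcases h c hup with hno | ⟨j, hj, hjno⟩
  · apply hno; rw [PQ_add_smul_slot, mem_Xof_Q] at htarget; exact htarget
  · apply hjno
    have := hpos (slotSite j) (slotSite_mem j) (by rw [F.hinner]; positivity)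
    rwa [PQ_add_slot, mem_Xof_Q] at this

/-- Not moving under ANY word version, for the direction `τ • Φ(sᵢ)`. -/
theorem RatFrame.not_isMoving_any (F : RatFrame) {S : Finset (Fin 3 → ℤ)} {v : Fin 3 → ℚ} (ver : WordVersion) (i : Fin 12) (τ : ℤ)
    (hfull : fullQ F.g (SQ S) v = false) (htw : ∀ c : Fin 8, twinFailQ F.g F.w (SQ S) v c = true)
    (hnar : narrowFailQ F.g (SQ S) v i τ = true) :
    ¬ IsMoving (Xof S) ver F.Φ ((τ : ℝ) • F.Φ (slotSite i)) (PQ v) := by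
  rintro (h | ⟨m, hm, -⟩ | ⟨-, h⟩)
  · have := (F.isFull_iff S v).1 h
    rw [hfull] at this
    exact Bool.false_ne_true this
  · exact F.not_twinReading htw m hm
  · exact F.not_isNarrow hnar h

/-- In a rational frame `gᵢ · w_c = 3 (sᵢ · c)` (from `hslot` and `hinner`). -/
theorem RatFrame.dq_g_w (F : RatFrame) (i : Fin 12) (c : Fin 8) : dq (F.g i) (F.w c) = 3 * dz (slotInt i) (cubeInt c) := by
  have h := F.hinner i c
  rw [F.hslot, inner_Qr_iptQ_nv] at h
  have h6 : (0 : ℝ) < Real.sqrt 6 := sqrt6_pos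
  have h66 : Real.sqrt 6 * Real.sqrt 6 = 6 := Real.mul_self_sqrt (by norm_num)
  have h62 : Real.sqrt 6 ^ 2 = 6 := Real.sq_sqrt (by norm_num)
  have : (dq (F.g i) (F.w c) : ℝ) = 3 * (dz (slotInt i) (cubeInt c) : ℝ) := by
    field_simp at h
    rw [h62] at h
    linarith
  exact_mod_cast this

/-- The mirrored slot is the slot image of the reflected frame. -/
theorem RatFrame.mirQ_eq_reflect_g (F : RatFrame) (i : Fin 12) (c : Fin 8) : mirQ F.g F.w i c = (F.reflect c).g i := by
  show mirQ F.g F.w i c = rq (F.w c) (F.g i)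
  rw [mirQ, rq, F.dq_g_w]
  congr 1
  push_cast; ring

/-! ### §14 Version-generic end moves -/

/-- Straight end move `q → b = q + τ gᵢ` from a FULL predecessor, any version. -/
theorem RatFrame.isEndMove_full_any (F : RatFrame) {S : Finset (Fin 3 → ℤ)} (ver : WordVersion) (q b : Fin 3 → ℚ) (i : Fin 12)
    (τ : ℤ) (hbq : b = q + (τ : ℚ) • F.g i) (hq : fullQ F.g (SQ S) q = true) (hb : fullQ F.g (SQ S) b = false)
    (htw : ∀ c : Fin 8, twinFailQ F.g F.w (SQ S) b c = true) (hnar : narrowFailQ F.g (SQ S) b i τ = true) :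
    IsEndMove (Xof S) ver F.Φ ((τ : ℝ) • F.Φ (slotSite i)) (PQ q) (PQ b) := by
  subst hbq
  exact Or.inl ⟨Or.inl ((F.isFull_iff S q).2 hq), (PQ_add_smul_slot F q i τ).symm, F.not_isMoving_any ver i τ hb htw hnar⟩

/-- Straight end move from a GLIDING predecessor, any version. -/
theorem RatFrame.isEndMove_glide_any (F : RatFrame) {S : Finset (Fin 3 → ℤ)} (ver : WordVersion) (q b : Fin 3 → ℚ) (i : Fin 12)
    (τ : ℤ) (c : Fin 8) (hbq : b = q + (τ : ℚ) • F.g i) (hq : twinOKQ F.g F.w (SQ S) q c = true)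
    (hperp : dz (slotInt i) (cubeInt c) = 0) (hb : fullQ F.g (SQ S) b = false)
    (htw : ∀ c' : Fin 8, twinFailQ F.g F.w (SQ S) b c' = true) (hnar : narrowFailQ F.g (SQ S) b i τ = true) :
    IsEndMove (Xof S) ver F.Φ ((τ : ℝ) • F.Φ (slotSite i)) (PQ q) (PQ b) := by
  subst hbq
  refine Or.inl ⟨Or.inr (Or.inr ⟨nv (F.w c), F.twinReading_of c hq, ?_⟩), (PQ_add_smul_slot F q i τ).symm,
    F.not_isMoving_any ver i τ hb htw hnar⟩
  rw [inner_smul_slot_nv, hperp]; simp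

/-- Straight end move from a NARROW predecessor (version `v2`). -/
theorem RatFrame.isEndMove_narrow (F : RatFrame) {S : Finset (Fin 3 → ℤ)} (q b : Fin 3 → ℚ) (i : Fin 12) (τ : ℤ) (c : Fin 8)
    (hbq : b = q + (τ : ℚ) • F.g i) (hq : narrowOKQ F.g (SQ S) q i τ c = true) (hb : fullQ F.g (SQ S) b = false)
    (htw : ∀ c' : Fin 8, twinFailQ F.g F.w (SQ S) b c' = true) (hnar : narrowFailQ F.g (SQ S) b i τ = true) :
    IsEndMove (Xof S) WordVersion.v2 F.Φ ((τ : ℝ) • F.Φ (slotSite i)) (PQ q) (PQ b) := by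
  subst hbq
  exact Or.inl ⟨Or.inr (Or.inl ⟨rfl, F.isNarrow_of hq⟩), (PQ_add_smul_slot F q i τ).symm,
    F.not_isMoving_any WordVersion.v2 i τ hb htw hnar⟩

/-- CROSS end move, any version: the target direction in the reflected frame is `(−σ) • Φ'(sᵢ)`. -/
theorem RatFrame.isEndMove_cross_any (F : RatFrame) {S : Finset (Fin 3 → ℤ)} (ver : WordVersion) (q b : Fin 3 → ℚ) (i : Fin 12)
    (c : Fin 8) (σ : ℤ) (hup : σ * dz (slotInt i) (cubeInt c) = 2)
    (hbq : b = q - (σ : ℚ) • mirQ F.g F.w i c)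
    (hq : twinOKQ F.g F.w (SQ S) q c = true)
    (hb : fullQ (F.reflect c).g (SQ S) b = false)
    (htw : ∀ c' : Fin 8, twinFailQ (F.reflect c).g (F.reflect c).w (SQ S) b c' = true)
    (hnar : narrowFailQ (F.reflect c).g (SQ S) b i (-σ) = true) :
    IsEndMove (Xof S) ver F.Φ ((σ : ℝ) • F.Φ (slotSite i)) (PQ q) (PQ b) := by
  have h6 := sqrt6_pos
  have h6' : Real.sqrt 6 ≠ 0 := ne_of_gt h6
  have hdm : ⟪(σ : ℝ) • F.Φ (slotSite i), nv (F.w c)⟫_ℝ = Real.sqrt (2 / 3) := by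
    rw [inner_smul_slot_nv, hup, ← two_div_sqrt_six]; push_cast; rfl
  have hmirdir : (σ : ℝ) • F.Φ (slotSite i) - (2 * ⟪(σ : ℝ) • F.Φ (slotSite i), nv (F.w c)⟫_ℝ) • nv (F.w c) =
      (σ : ℝ) • Qr (iptQ (mirQ F.g F.w i c)) := by
    rw [← F.mirror_eq, real_inner_smul_left, smul_sub, smul_smul]
    congr 1
    congr 1
    ring
  -- the mirrored slot is the slot image of the reflected frame
  have hg' : Qr (iptQ (mirQ F.g F.w i c)) = (F.reflect c).Φ (slotSite i) := by
    rw [(F.reflect c).hslot, F.mirQ_eq_reflect_g]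
  have hbq' : PQ b = PQ q - ((σ : ℝ) • F.Φ (slotSite i) - (2 * ⟪(σ : ℝ) • F.Φ (slotSite i), nv (F.w c)⟫_ℝ) • nv (F.w c)) := by
    rw [hmirdir, hbq, PQ, PQ, iptQ_sub, map_sub, iptQ_smul, map_smul]; push_cast; rfl
  refine Or.inr ⟨nv (F.w c), F.twinReading_of c hq, hdm, hbq', ?_⟩
  have hframe : F.Φ.trans (ℝ ∙ nv (F.w c))ᗮ.reflection = (F.reflect c).Φ := rfl
  have hdir : PQ b - PQ q = (((-σ : ℤ) : ℝ)) • (F.reflect c).Φ (slotSite i) := by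
    rw [hbq', hmirdir, hg']; push_cast
    simp [sub_eq_add_neg, neg_smul]
  rw [hframe, hdir]
  exact (F.reflect c).not_isMoving_any ver i (-σ) hb htw hnar

end EndRowFloor

end Summit.Ventures.Crystal3D.Theorems

end
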